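import Summits.QuantumFields.YangMills.Theorems.UnitScaleTiltProp7TrueAvgBudgetOfRLegs
import Summits.QuantumFields.YangMills.Theorems.UnitScaleTiltProp7RLegsLinTowerRowsT3
import HarnessLib

/-!
# Route `UnitScaleTilt`, crux K1 «MinimiserStabilityRegPr» (stmt-QuantumFields-19200), stub `stub_existenceMinimalOrbit` (EX), LANE II (B4★)∕(QB)∕(ENG) —
# ★★★ THE EX FACE ROW `hEng` AND THE ROW (QB) HOLD — NO HYPOTHESIS LEFT: `hEng_holds (c₀ cB a₀) (ha₀) : ⟨hEng⟩`, `hQB_holds : ⟨hQB⟩`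

Cell `ym3-torus` (HUMAN RULING D-0037, YM ladder rung R3 — YM₃ on T³ is a rung, NOT d = 4, NOT infinite volume, NOT a mass gap, NOT Clay; the YM gap is NOT proved),
width seat `ym3-torus-px19` (gen 7; the lineage's (QB) pen).  THEOREMS ONLY (0 `def`, 0 `sorry`); `--supports stmt-QuantumFields-19200 --as helper`, count-neutral; nothing
here claims the stub, the crux or any summit statement — `hEng` is ONE displayed hypothesis of the lane-II door inside the EX display, not the stub.

THE CHAIN, ALL IN THE TREE BY NAME.
  px18 ✓`Prop7RLegsLinTowerRowsT3.rlegs_of_regPr` — the curved corner-frame legs row (R-LEGS) at every printed-regular member, unconditionally (★routeR's (II)-comb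
  machinery F-9 ∘ w4-20520's (R-LEGS) knit ✓`Prop7RLegsCovKnit.rlegs_of_linTower_rows`; [Balaban1985Averaging] (110)–(112), (125)–(127), (160)–(163))
  ⟹ px19 ✓`Prop7TrueAvgBudgetOfRLegs.hQB_of_rlegs` — (QB) «true average ≤ twisted average + legs» for every `M₂(ℂ)`-valued one-form ([Balaban1985BackgroundPropagators] (3.13)–(3.15))
  ⟹ px19 g6 ✓`Prop7EngOfTrueAvgBudget.hEng_of_trueAvgBudget` — (ENG): the engine row of the divergence-recovery door (the linearised-subspace core budget of
  [Balaban1985BackgroundPropagators] Thm 3.11 at the member, [Balaban1985Variational] (14), (44)).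
So the lane-II door ✓`Prop7HcoOfDivRecovery.hN06_of_divRecovery c₀ cB a₀ ha₀ hEng (…)` takes `hEng := hEng_holds c₀ cB a₀ ha₀` and the EX display drops the row.

WHAT IS PROVED (ns `…Theorems.Prop7EngRowHolds`): ★★`hQB_holds` (= ✓p706335's `hQB` binder VERBATIM, as a theorem), ★★★`hEng_holds` (= ✓p702330's `hEng` binder = the S-face
row VERBATIM, as a theorem; hypotheses: the door's constants `c₀ cB a₀` with their positivity facts only).  Both `exact` compositions.
HONEST SCOPE.  Compositions by name; nothing of (REC), `hN06`, `hQH1`, `hPatch`, EX or the crux is proved here; nothing continuum ∕ OS ∕ mass-gap ∕ Clay.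

References: T. Bałaban, CMP **98** (1985) 17–51 [Balaban1985Averaging] ((110)–(112) p.34, (125)–(127) pp.36–37, (160)–(163) p.42); CMP **99** (1985) 389–434
[Balaban1985BackgroundPropagators] ((3.13) p.392, (3.14)–(3.15) p.393, Thm 3.11 p.416); CMP **102** (1985) 277–309 [Balaban1985Variational] ((14) p.280, (44) p.285).
-/

set_option autoImplicit false

noncomputable section

open scoped BigOperators Matrix.Norms.L2Operator Matrix InnerProductSpace

namespace Summit.QuantumFields.YangMills.Theorems.Prop7EngRowHolds

open Literature.MathematicalPhysics.QuantumFieldTheory.Balaban1983to89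
open Literature.MathematicalPhysics.QuantumFieldTheory.Balaban1983to89.T3ContinuumYM3Torus
open Literature.MathematicalPhysics.QuantumFieldTheory.Balaban1983to89.T3PrintedRegularMinimiser (RegPr)
open Finset T4Continuum BlockAveraging AveragingRT ExpMeanLog BlockAveragingEMLLinearised BlockAveragingEMLLinearisedBackground
open T3LevelShift (bondShift)
open T3PrintedRegularOrbits (sites_eq)
open B9Eq39Adjoint (curl divB)
open B10Eq27TorusAxialLog (unitsField toUField)
open B9TorusCalculus (torusT)
open B11Eq103H1Complex (BondL2K)
open Summit.QuantumFields.YangMills.Theorems.Prop7SectET3Transport (periodsT3)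
open Summit.QuantumFields.YangMills.Theorems.Prop7SectET3HilbertLetters (W₂ frobEquiv DstarL2)
open Summit.QuantumFields.YangMills.Theorems.Prop7SectET3WilsonHessian (DeltaEtaSlot)
open Summit.QuantumFields.YangMills.Theorems.Prop7SectET3CombLetters (Qkc)
open Summit.QuantumFields.YangMills.Theorems.Prop7SymAvgTw (QTw)
open Summit.QuantumFields.YangMills.Theorems.Prop7RLegsLinTowerRowsT3 (rlegs_of_regPr)
open Summit.QuantumFields.YangMills.Theorems.Prop7TrueAvgBudgetOfRLegs (hQB_of_rlegs hEng_of_rlegs)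

/-- ★★ **(QB) HOLDS**: «true average ≤ twisted average + legs» for every `M₂(ℂ)`-valued one-form at every printed-regular member — ✓p706335's displayed `hQB`, as a theorem
(✓`hQB_of_rlegs` ∘ px18 ✓`rlegs_of_regPr`). [cite: Balaban1985BackgroundPropagators, (3.13) p.392, (3.14)-(3.15) p.393; Balaban1985Averaging, (125)-(127) pp.36-37, (160) p.42] -/
theorem hQB_holds :
    ∀ (L : ℕ), 1 < L → ∃ Cq Cq' eq : ℝ, 0 ≤ Cq ∧ 0 ≤ Cq' ∧ 0 < eq ∧
      ∀ (F : T3Family), F.L = L → ∀ (n K : ℕ) (hnK : n < K) (e : ℝ) (W : GaugeField (F.P K) 0 (Matrix.specialUnitaryGroup (Fin 2) ℂ)),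
        0 < e → e ≤ eq → RegPr F n K e W →
        ∀ (Q : (k : ℕ) → (PBond (F.P K) 0 → Matrix (Fin 2) (Fin 2) ℂ) → PBond (F.P K) k → Matrix (Fin 2) (Fin 2) ℂ), (∀ Y, Q 0 Y = Y) →
        (∀ (k : ℕ) (Y : PBond (F.P K) 0 → Matrix (Fin 2) (Fin 2) ℂ) (c : PBond (F.P K) (k + 1)), Q (k + 1) Y c
          = (fderiv ℂ (eml : (Idx (F.P K) → Matrix (Fin 2) (Fin 2) ℂ) → Matrix (Fin 2) (Fin 2) ℂ)
                (fun i => ((loopHol (Averaging.iter (fun i => blockAvg (P := (F.P K)) (j := i) (expMeanLogSU (n := Fin 2))) k W) c i : Matrix.specialUnitaryGroup (Fin 2) ℂ) : Matrix (Fin 2) (Fin 2) ℂ))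
                (fun i => covWalkSum (Averaging.iter (fun i => blockAvg (P := (F.P K)) (j := i) (expMeanLogSU (n := Fin 2))) k W) (Q k Y) (walk (emb c.src) (loopWord (F.P K).L c.dir (off i.1) i.2.1 i.2.2))
                  * ((loopHol (Averaging.iter (fun i => blockAvg (P := (F.P K)) (j := i) (expMeanLogSU (n := Fin 2))) k W) c i : Matrix.specialUnitaryGroup (Fin 2) ℂ) : Matrix (Fin 2) (Fin 2) ℂ))
                * star ((corr (expMeanLogSU (n := Fin 2)) (Averaging.iter (fun i => blockAvg (P := (F.P K)) (j := i) (expMeanLogSU (n := Fin 2))) k W) c : Matrix.specialUnitaryGroup (Fin 2) ℂ) : Matrix (Fin 2) (Fin 2) ℂ)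
              + ((corr (expMeanLogSU (n := Fin 2)) (Averaging.iter (fun i => blockAvg (P := (F.P K)) (j := i) (expMeanLogSU (n := Fin 2))) k W) c : Matrix.specialUnitaryGroup (Fin 2) ℂ) : Matrix (Fin 2) (Fin 2) ℂ)
                * covWalkSum (Averaging.iter (fun i => blockAvg (P := (F.P K)) (j := i) (expMeanLogSU (n := Fin 2))) k W) (Q k Y) (walk (emb c.src) (List.replicate (F.P K).L (c.dir, true)))
                * star ((corr (expMeanLogSU (n := Fin 2)) (Averaging.iter (fun i => blockAvg (P := (F.P K)) (j := i) (expMeanLogSU (n := Fin 2))) k W) c : Matrix.specialUnitaryGroup (Fin 2) ℂ) : Matrix (Fin 2) (Fin 2) ℂ))) →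
        ∀ (A : PBond (F.P K) 0 → Matrix (Fin 2) (Fin 2) ℂ),
          ∑ c : PBond (F.P K) (K - n), ‖Q (K - n) A c‖ ^ 2
            ≤ 2 * (∑ c : PBond (F.P n) 0, ‖(frobEquiv.symm (QTw F n K hnK.le W A c) : W₂)‖ ^ 2)
              + Cq * (F.L : ℝ) ^ (K - n) * ((∑ x : Site (F.P K) 0, ∑ μ : Fin (F.P K).d, ∑ ν : Fin (F.P K).d,
                    (if μ < ν then ∑ j : Fin 2, ∑ k : Fin 2,
                      ‖(curl (torusT (F.P K) 0) (fun κ z => unitsField (toUField W) ⟨z, κ⟩) (fun κ z => A ⟨z, κ⟩) μ ν x) j k‖ ^ 2 else 0))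
                  + (∑ x : Site (F.P K) 0, ∑ j : Fin 2, ∑ k : Fin 2,
                    ‖(divB (torusT (F.P K) 0) (fun κ z => unitsField (toUField W) ⟨z, κ⟩) (fun κ z => A ⟨z, κ⟩) x) j k‖ ^ 2))
              + Cq' * e * ((F.L : ℝ) ^ (K - n))⁻¹ * (∑ b : PBond (F.P K) 0, ‖A b‖ ^ 2) :=
  hQB_of_rlegs rlegs_of_regPr

/-- ★★★ **THE EX FACE ROW `hEng` HOLDS**: the E′ engine row of the lane-II door (✓p702330's binder = SKELETON v1.2 :94 = the S-face display row VERBATIM) is a theorem of the door's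
constants alone — ✓`hEng_of_rlegs` ∘ px18 ✓`rlegs_of_regPr`. [cite: Balaban1985BackgroundPropagators, Thm 3.11 p.416, (3.13) p.392, (3.14)-(3.15) p.393; Balaban1985Variational, (14) p.280, (44) p.285] -/
theorem hEng_holds (c₀ cB a₀ : ℕ → ℝ) [∀ L : ℕ, Fact (0 < c₀ L)] [∀ L : ℕ, Fact (0 < cB L)]
    (ha₀ : ∀ L : ℕ, 1 < L → 0 < a₀ L) :
    ∀ (L : ℕ), 1 < L → ∃ γE κD κQ θE eE : ℝ, 0 < γE ∧ 0 ≤ κD ∧ 0 ≤ κQ ∧ 0 ≤ θE ∧ 0 < eE ∧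
      ∀ (F : T3Family), F.L = L → ∀ (n K : ℕ) (hnK : n < K) (e : ℝ) (W : GaugeField (F.P K) 0 (Matrix.specialUnitaryGroup (Fin 2) ℂ)),
        0 < e → e ≤ eE → RegPr F n K e W →
        ∀ y : BondL2K ℂ 3 (periodsT3 F K) (c₀ F.L) W₂,
          γE * ‖y‖ ^ 2 ≤ RCLike.re ⟪y, DeltaEtaSlot F n K (c₀ F.L) W y⟫_ℂ + κD * ‖DstarL2 F n K (c₀ F.L) W y‖ ^ 2
            + κQ * ((a₀ F.L * (c₀ F.L / cB F.L) * ((F.L : ℝ) ^ (K - n)) ^ 3) * ‖Qkc F n K hnK.le (c₀ F.L) (cB F.L) W y‖ ^ 2) + θE * e * ‖y‖ ^ 2 :=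
  hEng_of_rlegs c₀ cB a₀ ha₀ rlegs_of_regPr

end Summit.QuantumFields.YangMills.Theorems.Prop7EngRowHolds

end
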